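import Literature.Analysis.Complex.TubeFourierWindow
import Literature.Analysis.Complex.OsgoodProofs
import Mathlib.Analysis.Convex.Topology
import HarnessLib

/-!
# Bochner's tube theorem by Fourier analysis, II: extension to the convex hull and the sharp maximum principle

Analysis/Complex support file (everything proved; no named facts), sequel of
`TubeFourierWindow`. **Bochner's tube theorem** (bounded version): let `B ⊆ ℝᵏ` be open and
star-shaped with respect to `0 ∈ B`, and let `F` be holomorphic on the tube `T(B) = ℝᵏ + iB` and
bounded on `ℝᵏ + iK` for every compact `K ⊆ B`. Then `F` extends to a function holomorphic on the
tube `T(conv B)` over the **convex hull**, bounded on `ℝᵏ + iK'` for every compact `K' ⊆ conv B`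
(`exists_holomorphic_extension_convexHull`); the extension is unique, and if `‖F‖ ≤ M` on `T(B)`
then `‖F̃‖ ≤ M` on `T(conv B)` (`exists_holomorphic_extension_convexHull_of_bound`, the **sharp
maximum principle** `sup_{T(conv B)} |F̃| = sup_{T(B)} |F|`).

The extension is explicit: with the windowed Fourier data `Ψ_0` of `TubeFourierWindow`,

  `F̃(z) = G_b(z)⁻¹ ∫ Ψ_0(p) e^{2πi p·z} dp`   (`tubeExt F b z`),

which converges and is holomorphic on `T(conv B)` because `Ψ_0` decays like
`e^{2π p·y⋆ - 2πδ‖p‖}` at every `y⋆ ∈ conv B` (`TubeFourier.exists_norm_windowFT_zero_le`: the best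
of finitely many surrounding heights of `B`), and equals `F` on `T(B)` by Fourier inversion
(`TubeFourier.apply_mul_gw_eq_integral_windowFT`). Bounds uniform in `Re z` come from re-centring
the Gaussian window (translating `F` in the real directions gives the same extension by the
identity theorem, and at the centre the window costs nothing); the sharp bound `‖F̃‖ ≤ M` from
applying the qualitative theorem to `1/(F - c)`, `|c| > M`: its extension inverts `F̃ - c` on
`T(conv B)` by the identity theorem, so `F̃` omits every value of modulus `> M`.

This is the tube theorem in the form used at every step of the Osterwalder–Schrader
continuation of Euclidean Green's functions (Comm. Math. Phys. 42 (1975), Ch. V, (5.22)–(5.23),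
and Ch. VI, (6.15): "we can use the maximum principle (see (6.15) and e.g. Vladimirov p. 178) …
`sup_{Ẑ} |R| = sup_{Z} |R|`"). Classical references: S. Bochner, *A theorem on analytic
continuation of functions in several variables*, Ann. Math. 39 (1938); V. S. Vladimirov, *Methods
of the Theory of Functions of Many Complex Variables* (1966), §20.2 (functions of slow growth, by
Fourier–Laplace transform) and §17; L. Hörmander, *An Introduction to Complex Analysis in Several
Variables*, Thm. 2.5.10. Everything here is elementary given part I and is tagged folklore.
-/

noncomputable section

open _root_.Complex Set MeasureTheory Filter Metric Real
open scoped _root_.Topology FourierTransform RealInnerProductSpace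

namespace Literature.Analysis.Complex

namespace TubeFourier

variable {k : ℕ}

local notation "𝕍" => EuclideanSpace ℝ (Fin k)

variable (F : (Fin k → ℂ) → ℂ) (b : ℝ)

/-- The **Fourier–Laplace extension** `F̃(z) = G_b(z)⁻¹ ∫ Ψ_0(p) e^{2πi p·z} dp`. [folklore] -/
def tubeExt (z : Fin k → ℂ) : ℂ :=
  (gw b z)⁻¹ * ∫ p : 𝕍, windowFT F b 0 p * cexp (2 * π * I * ∑ j, (p j : ℂ) * z j)

variable {F b}

/-! ### Holomorphy of the extension on the tube over the convex hull -/

/-- The windowed Fourier data at height `0 ∈ B` are continuous in `p`. [folklore] -/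
theorem continuous_windowFT_zero (hb : 0 < b) {B : Set 𝕍} (h0 : (0 : 𝕍) ∈ B)
    (hFd : DifferentiableOn ℂ F (tube B))
    (hbd : ∀ K ⊆ B, IsCompact K → ∃ M : ℝ, ∀ x, ∀ y ∈ K, ‖F (cpt x y)‖ ≤ M) :
    Continuous (windowFT F b 0) := by
  obtain ⟨M, hM⟩ := hbd {0} (by simpa using h0) isCompact_singleton
  have hint : Integrable (slice F b 0) := integrable_slice hb hFd.continuousOn h0 fun x => hM x 0 rfl
  have hc : Continuous (𝓕 (slice F b 0)) :=
    VectorFourier.fourierIntegral_continuous Real.continuous_fourierChar (by exact continuous_inner)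
      hint
  have heq : windowFT F b 0 = 𝓕 (slice F b 0) := by
    funext p
    rw [windowFT_eq_fourier]
    simp
  rw [heq]
  exact hc

/-- The Fourier–Laplace kernel is entire in `z`. [folklore] -/
theorem differentiable_cexp_two_pi_I_sum (p : 𝕍) :
    Differentiable ℂ fun z : Fin k → ℂ => cexp (2 * π * I * ∑ j, (p j : ℂ) * z j) := by
  refine Complex.differentiable_exp.comp ((differentiable_const _).mul ?_)
  exact Differentiable.fun_sum fun j _ => (differentiable_const _).mul (differentiable_apply j)

/-- The Fourier–Laplace kernel is continuous in `p`. [folklore] -/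
theorem continuous_cexp_two_pi_I_sum_left (z : Fin k → ℂ) :
    Continuous fun p : 𝕍 => cexp (2 * π * I * ∑ j, (p j : ℂ) * z j) := by
  refine Complex.continuous_exp.comp (continuous_const.mul ?_)
  refine continuous_finsetSum _ fun j _ => ?_
  exact (Complex.continuous_ofReal.comp (PiLp.continuous_apply 2 _ j)).mul continuous_const

/-- Domination of the Fourier–Laplace integrand near a point of the tube over the convex hull:
if `‖Ψ_0(p)‖ ≤ A e^{2π y⋆·p} e^{-2πδ‖p‖}` and `‖Im z - y⋆‖ ≤ δ/2` then
`‖Ψ_0(p) e^{2πi p·z}‖ ≤ A e^{-πδ‖p‖}`. [folklore] -/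
theorem norm_windowFT_mul_cexp_le {A δ : ℝ} {ystar : 𝕍}
    (hA : ∀ p : 𝕍, ‖windowFT F b 0 p‖ ≤
      A * Real.exp (2 * π * ⟪ystar, p⟫) * Real.exp (-(2 * π * δ * ‖p‖)))
    {z : Fin k → ℂ} (hz : ‖imv z - ystar‖ ≤ δ / 2) (p : 𝕍) :
    ‖windowFT F b 0 p * cexp (2 * π * I * ∑ j, (p j : ℂ) * z j)‖ ≤ A * Real.exp (-(π * δ * ‖p‖)) := by
  have hA0 : 0 ≤ A := by
    have h := hA 0
    simp only [inner_zero_right, mul_zero, Real.exp_zero, mul_one, norm_zero, neg_zero] at h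
    exact (norm_nonneg _).trans (by simpa using h)
  rw [norm_mul, norm_cexp_two_pi_I_sum]
  refine (mul_le_mul_of_nonneg_right (hA p) (Real.exp_pos _).le).trans ?_
  have hinner : 2 * π * ⟪ystar, p⟫ + -(2 * π * ⟪imv z, p⟫) ≤ π * δ * ‖p‖ := by
    have h1 : ⟪ystar, p⟫ - ⟪imv z, p⟫ ≤ δ / 2 * ‖p‖ := by
      rw [← inner_sub_left]
      refine (real_inner_le_norm _ _).trans (mul_le_mul_of_nonneg_right ?_ (norm_nonneg _))
      rwa [norm_sub_rev]
    nlinarith [h1, Real.pi_pos]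
  calc A * Real.exp (2 * π * ⟪ystar, p⟫) * Real.exp (-(2 * π * δ * ‖p‖)) *
        Real.exp (-(2 * π * ⟪imv z, p⟫))
      = A * Real.exp (2 * π * ⟪ystar, p⟫ + -(2 * π * ⟪imv z, p⟫) + -(2 * π * δ * ‖p‖)) := by
        rw [Real.exp_add, Real.exp_add]; ring
    _ ≤ A * Real.exp (π * δ * ‖p‖ + -(2 * π * δ * ‖p‖)) := by
        gcongr
    _ = A * Real.exp (-(π * δ * ‖p‖)) := by congr 1; congr 1; ring

/-- **The Fourier–Laplace extension is holomorphic on the tube over the convex hull**: near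
`z₀`, `Im z₀ = y⋆ ∈ conv B`, the integrand is dominated by `A e^{-πδ‖p‖}` (decay of `Ψ_0` at `y⋆`
and `|e^{2πi p·z}| = e^{-2π p·Im z}`), so the dominated holomorphic parameter integral theorem
applies. [folklore] -/
theorem differentiableOn_tubeExt (hb : 0 < b) {B : Set 𝕍} (hBo : IsOpen B) (h0 : (0 : 𝕍) ∈ B)
    (hst : StarConvex ℝ 0 B) (hFd : DifferentiableOn ℂ F (tube B))
    (hbd : ∀ K ⊆ B, IsCompact K → ∃ M : ℝ, ∀ x, ∀ y ∈ K, ‖F (cpt x y)‖ ≤ M) :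
    DifferentiableOn ℂ (tubeExt F b) (tube (convexHull ℝ B)) := by
  have hUo : IsOpen (tube (convexHull ℝ B)) := isOpen_tube hBo.convexHull
  have hΨc : Continuous (windowFT F b 0) := continuous_windowFT_zero hb h0 hFd hbd
  refine ((differentiable_gw b).fun_inv (gw_ne_zero b)).differentiableOn.mul ?_
  refine differentiableOn_integral_of_dominated (μ := (volume : Measure 𝕍)) ?_ ?_ ?_
  · intro z _
    exact (hΨc.mul (continuous_cexp_two_pi_I_sum_left z)).aestronglyMeasurable
  · exact Eventually.of_forall fun p =>
      ((differentiable_const _).mul (differentiable_cexp_two_pi_I_sum p)).differentiableOn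
  · intro z₀ hz₀
    obtain ⟨A, δ, hδ, hA⟩ := exists_norm_windowFT_zero_le hb hBo hst hFd hbd (mem_tube.1 hz₀)
    obtain ⟨R₁, hR₁, hR₁U⟩ := Metric.isOpen_iff.1 hUo z₀ hz₀
    set R : ℝ := min R₁ (δ / (2 * (Real.sqrt k + 1))) with hR
    have hRpos : 0 < R := lt_min hR₁ (by positivity)
    refine ⟨R, hRpos, (ball_subset_ball (min_le_left _ _)).trans hR₁U,
      fun p => A * Real.exp (-(π * δ * ‖p‖)), ?_, ?_⟩
    · exact (integrable_exp_neg_mul_norm (by positivity : 0 < π * δ)).const_mul A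
    · refine Eventually.of_forall fun p z hz => norm_windowFT_mul_cexp_le hA ?_ p
      have h1 : ‖imv z - imv z₀‖ ≤ Real.sqrt k * ‖z - z₀‖ := norm_imv_sub_le z z₀
      have h2 : ‖z - z₀‖ < δ / (2 * (Real.sqrt k + 1)) :=
        (mem_ball_iff_norm.1 hz).trans_le (min_le_right _ _)
      have h3 : Real.sqrt k * ‖z - z₀‖ ≤ Real.sqrt k * (δ / (2 * (Real.sqrt k + 1))) :=
        mul_le_mul_of_nonneg_left h2.le (Real.sqrt_nonneg _)
      have h4 : Real.sqrt k * (δ / (2 * (Real.sqrt k + 1))) ≤ δ / 2 := by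
        rw [mul_div_assoc', div_le_div_iff₀ (by positivity) (by positivity)]
        nlinarith [Real.sqrt_nonneg (k : ℝ), hδ]
      linarith

/-! ### The extension agrees with `F` on the tube, and is unique -/

/-- **`F̃ = F` on `T(B)`** (Fourier inversion, part I). [folklore] -/
theorem tubeExt_eq (hb : 0 < b) {B : Set 𝕍} (hBo : IsOpen B) (hst : StarConvex ℝ 0 B)
    (hFd : DifferentiableOn ℂ F (tube B))
    (hbd : ∀ K ⊆ B, IsCompact K → ∃ M : ℝ, ∀ x, ∀ y ∈ K, ‖F (cpt x y)‖ ≤ M)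
    {z : Fin k → ℂ} (hz : z ∈ tube B) : tubeExt F b z = F z := by
  rw [tubeExt, ← apply_mul_gw_eq_integral_windowFT hb hBo hst hFd hbd hz, mul_comm (F z),
    ← mul_assoc, inv_mul_cancel₀ (gw_ne_zero b z), one_mul]

/-- **The identity theorem on the tube over the convex hull**: two functions holomorphic on
`T(conv B)` which agree on `T(B)` agree on `T(conv B)` (`T(conv B)` is convex, hence connected,
`T(B)` is open and nonempty; analyticity by Osgood's lemma). [folklore] -/
theorem eqOn_tube_convexHull_of_eqOn {B : Set 𝕍} (hBo : IsOpen B) (h0 : (0 : 𝕍) ∈ B)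
    {G H : (Fin k → ℂ) → ℂ} (hG : DifferentiableOn ℂ G (tube (convexHull ℝ B)))
    (hH : DifferentiableOn ℂ H (tube (convexHull ℝ B))) (hGH : EqOn G H (tube B)) :
    EqOn G H (tube (convexHull ℝ B)) := by
  have hUo : IsOpen (tube (convexHull ℝ B)) := isOpen_tube hBo.convexHull
  have hpre : IsPreconnected (tube (convexHull ℝ B)) :=
    (convex_tube (convex_convexHull ℝ B)).isPreconnected
  have hz₀ : cpt (0 : 𝕍) 0 ∈ tube B := cpt_mem_tube.2 h0
  refine (SCV.analyticOnNhd_of_differentiableOn hG hUo).eqOn_of_preconnected_of_eventuallyEq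
    (SCV.analyticOnNhd_of_differentiableOn hH hUo) hpre (tube_mono (subset_convexHull ℝ B) hz₀) ?_
  filter_upwards [(isOpen_tube hBo).mem_nhds hz₀] with w hw
  exact hGH hw

/-- **Uniqueness of holomorphic extensions to the tube over the convex hull**: a function
holomorphic on `T(conv B)` which agrees with `F` on `T(B)` is `F̃`. [folklore] -/
theorem eqOn_tubeExt (hb : 0 < b) {B : Set 𝕍} (hBo : IsOpen B) (h0 : (0 : 𝕍) ∈ B)
    (hst : StarConvex ℝ 0 B) (hFd : DifferentiableOn ℂ F (tube B))
    (hbd : ∀ K ⊆ B, IsCompact K → ∃ M : ℝ, ∀ x, ∀ y ∈ K, ‖F (cpt x y)‖ ≤ M)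
    {G : (Fin k → ℂ) → ℂ} (hG : DifferentiableOn ℂ G (tube (convexHull ℝ B)))
    (hGF : EqOn G F (tube B)) : EqOn G (tubeExt F b) (tube (convexHull ℝ B)) :=
  eqOn_tube_convexHull_of_eqOn hBo h0 hG (differentiableOn_tubeExt hb hBo h0 hst hFd hbd)
    fun w hw => by rw [hGF hw, tubeExt_eq hb hBo hst hFd hbd hw]

/-! ### Bounds uniform in the real part: re-centring the window -/

/-- Real translates of the tube are the tube. [folklore] -/
theorem imv_add_cpt_zero (w : Fin k → ℂ) (c : 𝕍) : imv (w + cpt c 0) = imv w := by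
  rw [imv_add, imv_cpt, add_zero]

/-- Subtraction of complex points in real/imaginary coordinates. [folklore] -/
theorem cpt_sub_cpt (x y x' y' : 𝕍) : cpt x y - cpt x' y' = cpt (x - x') (y - y') := by
  funext j; simp [cpt]; ring

/-- `‖G_b(iy)⁻¹‖ = e^{-b‖y‖²} ≤ 1`: at the centre the window costs nothing. [folklore] -/
theorem norm_gw_cpt_zero_inv_le (hb : 0 ≤ b) (y : 𝕍) : ‖(gw b (cpt 0 y))⁻¹‖ ≤ 1 := by
  rw [norm_inv, norm_gw_cpt, norm_zero]
  rw [inv_le_one_iff₀]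
  right
  refine Real.one_le_exp ?_
  nlinarith [sq_nonneg ‖y‖]

/-- **The bound on the extension near a point of the convex hull, uniformly in the real part.**
For `y⋆ ∈ conv B` there are `δ > 0` and `M'` with `‖F̃(z)‖ ≤ M'` whenever `z ∈ T(conv B)` and
`‖Im z - y⋆‖ ≤ δ`. Proof: translate `F` by `c = Re z` in the real directions; the translate has the
same bounds on the same heights, hence windowed Fourier data with the same decay constants, and
its extension `F̃_c(· - c)` coincides with `F̃` (uniqueness); at the point `z - c = i Im z` the
inverse window has modulus `≤ 1`. [folklore] -/
theorem exists_norm_tubeExt_le (hb : 0 < b) {B : Set 𝕍} (hBo : IsOpen B) (h0 : (0 : 𝕍) ∈ B)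
    (hst : StarConvex ℝ 0 B) (hFd : DifferentiableOn ℂ F (tube B))
    (hbd : ∀ K ⊆ B, IsCompact K → ∃ M : ℝ, ∀ x, ∀ y ∈ K, ‖F (cpt x y)‖ ≤ M)
    {ystar : 𝕍} (hy : ystar ∈ convexHull ℝ B) :
    ∃ δ : ℝ, 0 < δ ∧ ∃ M' : ℝ, ∀ z ∈ tube (convexHull ℝ B), ‖imv z - ystar‖ ≤ δ →
      ‖tubeExt F b z‖ ≤ M' := by
  -- decay constants valid for all real translates of `F`
  obtain ⟨S, δ, hδ, hSB, hsur⟩ := exists_surround_of_mem_convexHull hBo hy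
  obtain ⟨M, hM⟩ := hbd (S : Set 𝕍) (fun y hy => hSB y hy) S.finite_toSet.isCompact
  set A : ℝ := M * Real.exp (b * (∑ y ∈ S, ‖y‖) ^ 2) * (π / b) ^ ((k : ℝ) / 2) with hA
  refine ⟨δ / 2, half_pos hδ, A * ∫ p : 𝕍, Real.exp (-(π * δ * ‖p‖)), fun z hz hzy => ?_⟩
  -- the translate by `c = Re z`
  obtain ⟨c, hc⟩ : ∃ c : 𝕍, c = rev z := ⟨_, rfl⟩
  obtain ⟨y, hy'⟩ : ∃ y : 𝕍, y = imv z := ⟨_, rfl⟩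
  have hzc : z = cpt c y := by rw [hc, hy']; exact (cpt_rev_imv z).symm
  rw [← hy'] at hzy
  set Fc : (Fin k → ℂ) → ℂ := fun w => F (w + cpt c 0) with hFc
  have hshift : ∀ w, w + cpt c 0 ∈ tube B ↔ w ∈ tube B := fun w => by
    rw [mem_tube, mem_tube, imv_add_cpt_zero]
  have hFcd : DifferentiableOn ℂ Fc (tube B) :=
    hFd.comp (differentiable_id.add (differentiable_const _)).differentiableOn fun w hw =>
      (hshift w).2 hw
  have hFc_cpt : ∀ x y' : 𝕍, Fc (cpt x y') = F (cpt (x + c) y') := fun x y' => by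
    simp only [hFc, cpt_add_cpt, add_zero]
  have hbdc : ∀ K ⊆ B, IsCompact K → ∃ M : ℝ, ∀ x, ∀ y' ∈ K, ‖Fc (cpt x y')‖ ≤ M := by
    intro K hKB hKc
    obtain ⟨M₁, hM₁⟩ := hbd K hKB hKc
    exact ⟨M₁, fun x y' hy' => by rw [hFc_cpt]; exact hM₁ _ y' hy'⟩
  have hAc : ∀ p : 𝕍, ‖windowFT Fc b 0 p‖ ≤
      A * Real.exp (2 * π * ⟪ystar, p⟫) * Real.exp (-(2 * π * δ * ‖p‖)) := fun p =>
    norm_windowFT_zero_le_of_surround hb hBo hst hFcd hbdc hSB hsur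
      (fun x y' hy' => by rw [hFc_cpt]; exact hM _ y' hy')
      (fun y' hy' => Finset.single_le_sum (f := fun y => ‖y‖) (fun _ _ => norm_nonneg _) hy') p
  -- its extension, translated back, is `F̃`
  set G : (Fin k → ℂ) → ℂ := fun w => tubeExt Fc b (w - cpt c 0) with hG
  have hshift' : ∀ w, w - cpt c 0 ∈ tube (convexHull ℝ B) ↔ w ∈ tube (convexHull ℝ B) := fun w => by
    rw [mem_tube, mem_tube, sub_eq_add_neg, show -cpt c 0 = cpt (-c) (0 : 𝕍) by
      funext j; simp [cpt], imv_add_cpt_zero]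
  have hGd : DifferentiableOn ℂ G (tube (convexHull ℝ B)) :=
    (differentiableOn_tubeExt hb hBo h0 hst hFcd hbdc).comp
      (differentiable_id.sub (differentiable_const _)).differentiableOn fun w hw => (hshift' w).2 hw
  have hGF : EqOn G F (tube B) := by
    intro w hw
    have hw' : w - cpt c 0 ∈ tube B := by rw [← hshift, sub_add_cancel]; exact hw
    show tubeExt Fc b (w - cpt c 0) = F w
    rw [tubeExt_eq hb hBo hst hFcd hbdc hw']
    show F (w - cpt c 0 + cpt c 0) = F w
    rw [sub_add_cancel]
  have hEq : tubeExt F b z = tubeExt Fc b (cpt 0 y) := by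
    have h1 := eqOn_tubeExt hb hBo h0 hst hFd hbd hGd hGF hz
    have h2 : z - cpt c 0 = cpt 0 y := by rw [hzc, cpt_sub_cpt, sub_self, sub_zero]
    rw [← h1]
    show tubeExt Fc b (z - cpt c 0) = tubeExt Fc b (cpt 0 y)
    rw [h2]
  -- the bound at the purely imaginary point
  rw [hEq, tubeExt, norm_mul]
  have hint : ‖∫ p : 𝕍, windowFT Fc b 0 p * cexp (2 * π * I * ∑ j, (p j : ℂ) * cpt (0 : 𝕍) y j)‖ ≤
      ∫ p : 𝕍, A * Real.exp (-(π * δ * ‖p‖)) := by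
    refine norm_integral_le_of_norm_le
      ((integrable_exp_neg_mul_norm (by positivity : 0 < π * δ)).const_mul A)
      (Eventually.of_forall fun p => norm_windowFT_mul_cexp_le hAc ?_ p)
    rw [imv_cpt]
    exact hzy
  calc ‖(gw b (cpt 0 y))⁻¹‖ *
        ‖∫ p : 𝕍, windowFT Fc b 0 p * cexp (2 * π * I * ∑ j, (p j : ℂ) * cpt (0 : 𝕍) y j)‖
      ≤ 1 * ∫ p : 𝕍, A * Real.exp (-(π * δ * ‖p‖)) :=
        mul_le_mul (norm_gw_cpt_zero_inv_le hb.le y) hint (norm_nonneg _) zero_le_one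
    _ = A * ∫ p : 𝕍, Real.exp (-(π * δ * ‖p‖)) := by rw [one_mul, integral_const_mul]

/-- **Bounds on compact subtubes** from the local bounds, by compactness. [folklore] -/
theorem exists_norm_tubeExt_le_of_isCompact (hb : 0 < b) {B : Set 𝕍} (hBo : IsOpen B)
    (h0 : (0 : 𝕍) ∈ B) (hst : StarConvex ℝ 0 B) (hFd : DifferentiableOn ℂ F (tube B))
    (hbd : ∀ K ⊆ B, IsCompact K → ∃ M : ℝ, ∀ x, ∀ y ∈ K, ‖F (cpt x y)‖ ≤ M)
    {K : Set 𝕍} (hK : K ⊆ convexHull ℝ B) (hKc : IsCompact K) :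
    ∃ M' : ℝ, ∀ z : Fin k → ℂ, imv z ∈ K → ‖tubeExt F b z‖ ≤ M' := by
  suffices h : ∃ M' : ℝ, ∀ z : Fin k → ℂ, imv z ∈ K → imv z ∈ K → ‖tubeExt F b z‖ ≤ M' by
    obtain ⟨M', hM'⟩ := h
    exact ⟨M', fun z hz => hM' z hz hz⟩
  refine hKc.induction_on (p := fun S => ∃ M' : ℝ, ∀ z : Fin k → ℂ, imv z ∈ S → imv z ∈ K →
    ‖tubeExt F b z‖ ≤ M') ⟨0, fun z hz => hz.elim⟩ ?_ ?_ ?_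
  · intro S T hST hT
    obtain ⟨M', hM'⟩ := hT
    exact ⟨M', fun z hz hzK => hM' z (hST hz) hzK⟩
  · intro S T hS hT
    obtain ⟨M₁, hM₁⟩ := hS
    obtain ⟨M₂, hM₂⟩ := hT
    refine ⟨max M₁ M₂, fun z hz hzK => ?_⟩
    rcases hz with hz | hz
    · exact (hM₁ z hz hzK).trans (le_max_left _ _)
    · exact (hM₂ z hz hzK).trans (le_max_right _ _)
  · intro y hyK
    obtain ⟨δ, hδ, M', hM'⟩ := exists_norm_tubeExt_le hb hBo h0 hst hFd hbd (hK hyK)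
    refine ⟨closedBall y δ, mem_nhdsWithin_of_mem_nhds (closedBall_mem_nhds y hδ), M',
      fun z hz hzK => hM' z (mem_tube.2 (hK hzK)) ?_⟩
    rwa [mem_closedBall, dist_eq_norm] at hz

end TubeFourier

/-! ### Bochner's tube theorem -/

open TubeFourier

variable {k : ℕ}

local notation "𝕍" => EuclideanSpace ℝ (Fin k)

/-- **Bochner's tube theorem, bounded version, with uniqueness and bounds on compact subtubes.**
Let `B ⊆ ℝᵏ` be open and star-shaped with respect to `0 ∈ B`, and let `F` be holomorphic on the tube
`T(B) = {z | Im z ∈ B}` and bounded on `T(K)` for every compact `K ⊆ B`. Then there is `F̃`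
holomorphic on the tube `T(conv B)` over the convex hull, equal to `F` on `T(B)`, bounded on
`T(K')` for every compact `K' ⊆ conv B`, and unique among holomorphic functions on `T(conv B)`
extending `F`. (`F̃` is the Fourier–Laplace extension `TubeFourier.tubeExt F 1`; module
docstring. Classical statement for arbitrary connected open bases and without boundedness
hypotheses: Bochner (1938); Hörmander, *SCV*, Thm. 2.5.10; tempered version by the Fourier–Laplace
transform: Vladimirov (1966), §20.2.) [folklore] -/
theorem exists_holomorphic_extension_tube_convexHull {B : Set 𝕍} (hBo : IsOpen B)
    (h0 : (0 : 𝕍) ∈ B) (hst : StarConvex ℝ 0 B) {F : (Fin k → ℂ) → ℂ}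
    (hFd : DifferentiableOn ℂ F (tube B))
    (hbd : ∀ K ⊆ B, IsCompact K → ∃ M : ℝ, ∀ x, ∀ y ∈ K, ‖F (cpt x y)‖ ≤ M) :
    ∃ Fext : (Fin k → ℂ) → ℂ,
      DifferentiableOn ℂ Fext (tube (convexHull ℝ B)) ∧ EqOn Fext F (tube B) ∧
      (∀ K ⊆ convexHull ℝ B, IsCompact K → ∃ M' : ℝ, ∀ z, imv z ∈ K → ‖Fext z‖ ≤ M') ∧
      ∀ G : (Fin k → ℂ) → ℂ, DifferentiableOn ℂ G (tube (convexHull ℝ B)) →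
        EqOn G F (tube B) → EqOn G Fext (tube (convexHull ℝ B)) :=
  ⟨tubeExt F 1, differentiableOn_tubeExt one_pos hBo h0 hst hFd hbd,
    fun _ hz => tubeExt_eq one_pos hBo hst hFd hbd hz,
    fun _ hK hKc => exists_norm_tubeExt_le_of_isCompact one_pos hBo h0 hst hFd hbd hK hKc,
    fun _ hG hGF => eqOn_tubeExt one_pos hBo h0 hst hFd hbd hG hGF⟩

/-- **Bochner's tube theorem with the sharp maximum principle**
(`sup_{T(conv B)} |F̃| = sup_{T(B)} |F|`; Osterwalder–Schrader II, (6.15)). If `‖F‖ ≤ M` on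
`T(B)` then the holomorphic extension satisfies `‖F̃‖ ≤ M` on `T(conv B)`: otherwise pick `z₁` with
`c = F̃(z₁)`, `‖c‖ > M`; the function `(F - c)⁻¹` is holomorphic and bounded on `T(B)`, so it
extends to `g̃` on `T(conv B)`, and `(F̃ - c) g̃ = 1` on `T(B)`, hence on `T(conv B)` by the identity
theorem — absurd at `z₁`. [folklore] -/
theorem exists_holomorphic_extension_tube_convexHull_of_bound {B : Set 𝕍} (hBo : IsOpen B)
    (h0 : (0 : 𝕍) ∈ B) (hst : StarConvex ℝ 0 B) {F : (Fin k → ℂ) → ℂ}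
    (hFd : DifferentiableOn ℂ F (tube B)) {M : ℝ} (hM : ∀ z ∈ tube B, ‖F z‖ ≤ M) :
    ∃ Fext : (Fin k → ℂ) → ℂ,
      DifferentiableOn ℂ Fext (tube (convexHull ℝ B)) ∧ EqOn Fext F (tube B) ∧
      (∀ z ∈ tube (convexHull ℝ B), ‖Fext z‖ ≤ M) ∧
      ∀ G : (Fin k → ℂ) → ℂ, DifferentiableOn ℂ G (tube (convexHull ℝ B)) →
        EqOn G F (tube B) → EqOn G Fext (tube (convexHull ℝ B)) := by
  have hbd : ∀ K ⊆ B, IsCompact K → ∃ M₁ : ℝ, ∀ x, ∀ y ∈ K, ‖F (cpt x y)‖ ≤ M₁ :=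
    fun K hKB _ => ⟨M, fun x y hy => hM _ (cpt_mem_tube.2 (hKB hy))⟩
  obtain ⟨Fext, hFext, hEq, -, huniq⟩ := exists_holomorphic_extension_tube_convexHull hBo h0 hst hFd hbd
  refine ⟨Fext, hFext, hEq, fun z₁ hz₁ => ?_, huniq⟩
  by_contra hlt
  push Not at hlt
  set c : ℂ := Fext z₁ with hc
  -- `(F - c)⁻¹` is holomorphic and bounded on `T(B)`
  have hgap : ∀ z ∈ tube B, ‖c‖ - M ≤ ‖F z - c‖ := fun z hz => by
    have h := norm_sub_norm_le c (F z)
    rw [norm_sub_rev] at h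
    linarith [hM z hz]
  have hcM : 0 < ‖c‖ - M := by linarith
  have hne : ∀ z ∈ tube B, F z - c ≠ 0 := fun z hz h => by
    have h' := hgap z hz
    rw [h, norm_zero] at h'
    linarith
  have hgd : DifferentiableOn ℂ (fun z => (F z - c)⁻¹) (tube B) :=
    (hFd.sub (differentiableOn_const c)).fun_inv hne
  have hgb : ∀ K ⊆ B, IsCompact K → ∃ M₁ : ℝ, ∀ x, ∀ y ∈ K, ‖(F (cpt x y) - c)⁻¹‖ ≤ M₁ :=
    fun K hKB _ => ⟨(‖c‖ - M)⁻¹, fun x y hy => by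
      rw [norm_inv]
      exact inv_anti₀ hcM (hgap _ (cpt_mem_tube.2 (hKB hy)))⟩
  obtain ⟨gext, hgext, hgeq, -, -⟩ := exists_holomorphic_extension_tube_convexHull hBo h0 hst hgd hgb
  -- `(F̃ - c) g̃ = 1` on `T(conv B)`
  have hprod : EqOn (fun z => (Fext z - c) * gext z) (fun _ => 1) (tube (convexHull ℝ B)) := by
    refine eqOn_tube_convexHull_of_eqOn hBo h0
      ((hFext.sub (differentiableOn_const c)).mul hgext) (differentiableOn_const _) fun w hw => ?_
    show (Fext w - c) * gext w = 1
    rw [hEq hw, hgeq hw, mul_inv_cancel₀ (hne w hw)]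
  have h1 := hprod hz₁
  simp only [hc, sub_self, zero_mul] at h1
  exact zero_ne_one h1

end Literature.Analysis.Complex
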